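import Summits.ResolutionOfSingularities.ResolutionOfSingularities.Theorems.WeightedInvariantKRedWeightedDropHomDense
import HarnessLib

/-!
# (K-red), hypothesis-explicit form: `WeightedDropHom` descends along the base change `ψ : B → B̂` of the cobordant algebra, given only
# the two `ι`-equalities actually used

Route `ResolutionOfSingularities/WeightedInvariant`, door crux `HypersurfaceCentreConstruction` (stmt-ResolutionOfSingularities-19897), P3 rung; ORDER (o60)
of res-L1-w43-plan-1, companion of p551914 `…KRedWeightedDropHomDense` (res-type-060, gen 10).  [OURS · L1 W4.3 · helper, counted 0]  AI proof, weaker than expert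
review; bookkeeping on OUR clause vocabulary.

WHY: `KRed.weightedDropHom_of_dense` takes `IotaDenseCompatible ι` — `ι` constant along EVERY dense flat local map of Noetherian local rings.  That holds for
`ν` and `σ` (p551914), but the dimension-type letters of the door's `iotaFlatT` (`ε`, `τ`, the cylinder reading) should only be expected to transfer along
`S → Ŝ` and `B_𝔫 → B̂_𝔫̂` through the REGULARITY of these maps (excellence of the door's `S`, e.f.t. over a field).  This file therefore isolates the two
equalities the reduction uses as named hypotheses — `hιS : ι Ŝ (f·1) = ι S f` and `hιB : ι (B̂_𝔫̂) (ψ g) = ι (B_𝔫) g` at the `t`-homogeneous primes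
`𝔫 ⊇ 𝔪B`, `𝔫 ∋ t⁻¹`, off the vertex (`𝔫̂ = 𝔫·B̂`) — and proves everything else: **`KRed.weightedDropHom_of_baseChange`**; `KRed.iotaB_of_iotaDenseCompatible`
recovers `hιB` from `IotaDenseCompatible` (so p551914's theorem is the special case).
-/

noncomputable section

set_option linter.dupNamespace false -- mandated namespace of this single-conjunct summit

open IsLocalRing Literature.AlgebraicGeometry.Resolution
open Summit.ResolutionOfSingularities.ResolutionOfSingularities.Theorems
open scoped LaurentPolynomial

namespace Summit.ResolutionOfSingularities.ResolutionOfSingularities.Cruxes.HypersurfaceCentreConstruction.LocalEngine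

namespace KRed

variable {ι : (R : Type) → [CommRing R] → R → Ordinal.{0}}
  {S Ŝ : Type} [CommRing S] [CommRing Ŝ] [Algebra S Ŝ] [IsLocalRing S] [IsLocalRing Ŝ] [Module.Flat S Ŝ] {n : ℕ}
  (u : Fin n → S) (w : Fin n → ℕ)
  (ψ : cobordantAlgebra' u w →+* cobordantAlgebra' (fun i => algebraMap S Ŝ (u i)) w)
  (hψ : ∀ x : cobordantAlgebra' u w, ((ψ x : cobordantAlgebra' (fun i => algebraMap S Ŝ (u i)) w) : Ŝ[T;T⁻¹]) =
    AddMonoidAlgebra.mapRingHom ℤ (algebraMap S Ŝ) (x : S[T;T⁻¹]))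
  (hψv : (extReesAlgebra.vertexIdeal (weightedMonomialIdeal u w)).map ψ =
    extReesAlgebra.vertexIdeal (weightedMonomialIdeal (fun i => algebraMap S Ŝ (u i)) w))
  (hm : (maximalIdeal S).map (algebraMap S Ŝ) = maximalIdeal Ŝ)
  (hdense : ∀ (N : ℕ) (y : Ŝ), ∃ x : S, y - algebraMap S Ŝ x ∈ maximalIdeal Ŝ ^ N)

include hψ hψv hm hdense

/-- **(K-red), hypothesis-explicit form.**  Along the base change `ψ : B → B̂` of the cobordant algebra over a flat `S → Ŝ` with `𝔪Ŝ = 𝔪̂` and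
`Ŝ = S + 𝔪̂ᴺ` (the tree's `ψ` of `stub_extReesAlgebra_baseChange`, with its vertex clause `hψv`): if `ι Ŝ (f·1) = ι S f` and `ι` agrees along
`B_𝔫 → B̂_𝔫̂` (`𝔫̂ = 𝔫·B̂`) at every `t`-homogeneous prime `𝔫 ∋ t⁻¹` over `𝔪` off the vertex, then the (drop) conjunct at `t`-homogeneous successors
for `(Ŝ, f·1, 𝔪̂, û, w)` gives it for `(S, f, 𝔪, u, w)`. [OURS · L1 W4.3 · (o60) (K-red)] -/
theorem weightedDropHom_of_baseChange (f : S)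
    (hιS : ι Ŝ (algebraMap S Ŝ f) = ι S f)
    (hιB : ∀ (𝔫 : Ideal (cobordantAlgebra' u w)) [𝔫.IsPrime] [(𝔫.map ψ).IsPrime], IsTHomogeneous u w 𝔫 → cobordantT' u w ∈ 𝔫 →
      (maximalIdeal S).map (algebraMap S (cobordantAlgebra' u w)) ≤ 𝔫 → ¬ extReesAlgebra.vertexIdeal (weightedMonomialIdeal u w) ≤ 𝔫 →
      ∀ g : cobordantAlgebra' u w,
        ι (Localization.AtPrime (𝔫.map ψ)) (algebraMap _ (Localization.AtPrime (𝔫.map ψ)) (ψ g)) =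
          ι (Localization.AtPrime 𝔫) (algebraMap _ (Localization.AtPrime 𝔫) g))
    (h : WeightedDropHom ι Ŝ (algebraMap S Ŝ f) (maximalIdeal Ŝ) (fun i => algebraMap S Ŝ (u i)) w) :
    WeightedDropHom ι S f (maximalIdeal S) u w := by
  intro 𝔫 _ hhom hT h𝔪 hv a g hfac hndvd hsing
  haveI h𝔫' : (𝔫.map ψ).IsPrime := isPrime_map_psi u w ψ hψ hm hdense 𝔫 h𝔪
  have hcomap : (𝔫.map ψ).comap ψ = 𝔫 := comap_map_psi u w ψ hψ hm 𝔫
  have hT' : cobordantT' (fun i => algebraMap S Ŝ (u i)) w ∈ 𝔫.map ψ := by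
    rw [← psi_cobordantT' u w ψ hψ]
    exact Ideal.mem_map_of_mem ψ hT
  have h𝔪' : (maximalIdeal Ŝ).map (algebraMap Ŝ (cobordantAlgebra' (fun i => algebraMap S Ŝ (u i)) w)) ≤ 𝔫.map ψ := by
    rw [map_maximalIdeal_hat_eq u w ψ hψ hm]
    exact Ideal.map_mono h𝔪
  have hv' : ¬ extReesAlgebra.vertexIdeal (weightedMonomialIdeal (fun i => algebraMap S Ŝ (u i)) w) ≤ 𝔫.map ψ := fun hle => hv (by
    have := Ideal.comap_mono (f := ψ) hle
    rwa [← hψv, comap_map_psi u w ψ hψ hm, hcomap] at this)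
  have hfac' : algebraMap Ŝ (cobordantAlgebra' (fun i => algebraMap S Ŝ (u i)) w) (algebraMap S Ŝ f) =
      cobordantT' (fun i => algebraMap S Ŝ (u i)) w ^ a * ψ g := by
    rw [← psi_algebraMap u w ψ hψ f, hfac, map_mul, map_pow, psi_cobordantT' u w ψ hψ]
  have hndvd' : ¬ cobordantT' (fun i => algebraMap S Ŝ (u i)) w ∣ ψ g := fun hdvd => hndvd (by
    rw [← Ideal.mem_span_singleton] at hdvd ⊢
    rw [← psi_cobordantT' u w ψ hψ, ← Set.image_singleton, ← Ideal.map_span] at hdvd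
    rw [← comap_map_psi u w ψ hψ hm (Ideal.span {cobordantT' u w}), Ideal.mem_comap]
    exact hdvd)
  -- `g ∈ 𝔪_𝔫² ⇒ ψ g ∈ 𝔪_{𝔫̂}²` along the local map
  let L := Localization.localRingHom 𝔫 (𝔫.map ψ) ψ hcomap.symm
  have hL : ∀ x, L (algebraMap _ (Localization.AtPrime 𝔫) x) = algebraMap _ (Localization.AtPrime (𝔫.map ψ)) (ψ x) := fun x =>
    Localization.localRingHom_to_map 𝔫 (𝔫.map ψ) ψ hcomap.symm x
  have hmL := map_maximalIdeal_loc u w ψ 𝔫 (𝔫.map ψ) rfl (L₁ := Localization.AtPrime 𝔫) (L₂ := Localization.AtPrime (𝔫.map ψ)) L hL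
  have hsing' : algebraMap _ (Localization.AtPrime (𝔫.map ψ)) (ψ g) ∈ maximalIdeal (Localization.AtPrime (𝔫.map ψ)) ^ 2 := by
    rw [← hL g, ← hmL, ← Ideal.map_pow]
    exact Ideal.mem_map_of_mem _ hsing
  have key := h (𝔫.map ψ) (isTHomogeneous_map_psi u w ψ hψ hhom) hT' h𝔪' hv' a (ψ g) hfac' hndvd' hsing'
  rw [hιS, hιB 𝔫 hhom hT h𝔪 hv g] at key
  exact key

omit hψv in
/-- `IotaDenseCompatible ι` supplies the hypothesis `hιB` of `weightedDropHom_of_baseChange` (Noetherian `S`, `Ŝ`): along `B_𝔫 → B̂_𝔫̂` — flat with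
`𝔪·B̂_𝔫̂ = 𝔪̂` and dense (p551914 §2) — `ι` agrees. [OURS · L1 W4.3] -/
theorem iotaB_of_iotaDenseCompatible [IsNoetherianRing S] [IsNoetherianRing Ŝ] (hι : IotaDenseCompatible ι)
    (𝔫 : Ideal (cobordantAlgebra' u w)) [𝔫.IsPrime] [(𝔫.map ψ).IsPrime]
    (h𝔪 : (maximalIdeal S).map (algebraMap S (cobordantAlgebra' u w)) ≤ 𝔫) (g : cobordantAlgebra' u w) :
    ι (Localization.AtPrime (𝔫.map ψ)) (algebraMap _ (Localization.AtPrime (𝔫.map ψ)) (ψ g)) =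
      ι (Localization.AtPrime 𝔫) (algebraMap _ (Localization.AtPrime 𝔫) g) := by
  have hcomap : (𝔫.map ψ).comap ψ = 𝔫 := comap_map_psi u w ψ hψ hm 𝔫
  letI := ψ.toAlgebra
  haveI : (𝔫.map ψ).LiesOver 𝔫 := ⟨by rw [Ideal.under_def]; exact hcomap.symm⟩
  letI instA : Algebra (Localization.AtPrime 𝔫) (Localization.AtPrime (𝔫.map ψ)) :=
    Localization.AtPrime.algebraOfLiesOver 𝔫 (𝔫.map ψ)
  haveI : Module.FaithfullyFlat (cobordantAlgebra' u w) (cobordantAlgebra' (fun i => algebraMap S Ŝ (u i)) w) :=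
    faithfullyFlat_psi u w ψ hψ hm
  haveI instF : Module.Flat (Localization.AtPrime 𝔫) (Localization.AtPrime (𝔫.map ψ)) := inferInstance
  haveI : IsNoetherianRing (cobordantAlgebra' u w) := by
    show IsNoetherianRing (extReesAlgebra (weightedMonomialIdeal u w))
    rw [extReesAlgebra_weightedMonomialIdeal_eq_cobordantAlgebra u w]
    exact cobordantAlgebra.isNoetherianRing u w
  haveI : IsNoetherianRing (cobordantAlgebra' (fun i => algebraMap S Ŝ (u i)) w) := by
    show IsNoetherianRing (extReesAlgebra (weightedMonomialIdeal (fun i => algebraMap S Ŝ (u i)) w))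
    rw [extReesAlgebra_weightedMonomialIdeal_eq_cobordantAlgebra _ w]
    exact cobordantAlgebra.isNoetherianRing _ w
  haveI instN : IsNoetherianRing (Localization.AtPrime 𝔫) := IsLocalization.isNoetherianRing 𝔫.primeCompl _ inferInstance
  haveI instN' : IsNoetherianRing (Localization.AtPrime (𝔫.map ψ)) :=
    IsLocalization.isNoetherianRing (𝔫.map ψ).primeCompl _ inferInstance
  have hL : ∀ x, algebraMap (Localization.AtPrime 𝔫) (Localization.AtPrime (𝔫.map ψ)) (algebraMap _ (Localization.AtPrime 𝔫) x) =
      algebraMap _ (Localization.AtPrime (𝔫.map ψ)) (ψ x) := fun x =>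
    Localization.localRingHom_to_map 𝔫 (𝔫.map ψ) (algebraMap _ _) Ideal.LiesOver.over x
  have hmL := map_maximalIdeal_loc u w ψ 𝔫 (𝔫.map ψ) rfl (L₁ := Localization.AtPrime 𝔫)
    (L₂ := Localization.AtPrime (𝔫.map ψ)) (algebraMap _ _) hL
  have hdL := dense_loc u w ψ hψ hm hdense 𝔫 h𝔪 (𝔫.map ψ) rfl (L₁ := Localization.AtPrime 𝔫)
    (L₂ := Localization.AtPrime (𝔫.map ψ)) (algebraMap _ _) hL
  have := hι (Localization.AtPrime 𝔫) (Localization.AtPrime (𝔫.map ψ)) hmL hdL (algebraMap _ (Localization.AtPrime 𝔫) g)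
  rwa [hL g] at this

end KRed

end Summit.ResolutionOfSingularities.ResolutionOfSingularities.Cruxes.HypersurfaceCentreConstruction.LocalEngine
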